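import Summits.QuantumFields.BalabanUV.Beta.FP.CovarianceRowDiff
import Summits.QuantumFields.BalabanUV.Beta.FP.CovarianceConstraintRowSum
import Summits.QuantumFields.BalabanUV.Beta.FP.GaugeTermRoadLegsCol
import Summits.QuantumFields.BalabanUV.T4Continuum.Support.GradientRowSumTransport
import Literature.MathematicalPhysics.QuantumFieldTheory.Balaban1983to89.B5SiteBridgeP12

/-!
# `BalabanUV.Beta.FP.CovarianceRowDiffTower` — road «FP» (binder row D1), lane IR-5′, **THE (T1′) SOCKET, FILE F5e: THE VECTOR HALF OF THE TOWER LETTER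
# IS IN THE TREE** — on the tower tori (`N = Lc^K` fine steps per unit, CUBIC unit tori `M_ν = 2Lc^m`, `a = 1`) the GRADIENT row-sum letter of the hard
# covariance `Σ_j ‖𝒞(i+ê_μ) j − 𝒞 i j‖ ≤ C₁∕N` (the ONE displayed hypothesis `hC1` of F5b `PerfectFFBlockRowDiff` ∕ F5c `GaugeTermRoadLegsCol`) FOLLOWS from
# ONE displayed letter for the COMPOSITE free × coarse gauge factor, `Σ_j ‖((S_ν − 1)·(∂Δ⁻¹R·RΔ⁻¹∂ᴴ)) i j‖ ≤ ab∕N`: the VECTOR propagator's gradient letter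
# `Σ_j ‖((S_ν − 1)·Δ_1⁻¹) i j‖ ≤ g∕N` — (1.115)'s SECOND entry «|∇GJ| ≤ O(1)|J|» (B5 = Bałaban, CMP 95 (1984) p. 36) for `G = Δ_1⁻¹` in row-sum currency on
# cubic tori — IS A THEOREM OF THE TREE (t4-ne3-p1's flat-rung gradient `SliceFlatGradient.cubeSum_rowDiff_gFlat_le` transported by t4-ne2-formalise-leaf-05's
# `GradientRowSumTransport.weighted_row_sum_fdiff_inv_le_cubic`, read at weight `δ′ = 0`), and the two zeroth-order letters `c_C` (gan24 ∕ file 3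
# `CovarianceConstraintRowSum.exists_rowSum_constraint_le`), `c_G` (pv15 `B5G115RowSum.sum_norm_DeltaA_one_inv_le`) are theorems of the tree — our bookkeeping
# BY NAME over F5d `CovarianceRowDiff.sum_norm_Cov_rowDiff_le`; no estimate is proved here

HONEST DEPENDENCY (page 1, mandatory): continuum YM on T⁴ ⇐ BetaPertH ∧ nine spine estimates (0/9 proved); BetaPertH ⇐ (D1) ∧ (D4) ∧
CAP+tail; G-an2-4 gates asym, D1 and NE2/3/4.  HONEST FRAMING (cell contract, verbatim): «discharging `BetaPertH` makes Bałaban's UV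
stability UNCONDITIONAL — a real constructive-QFT result; it is NOT the continuum limit and NOT the Clay problem.»  THIS MODULE cites nothing, mints no
`Prop`, has no `def`, 0 sorry.  AFTER IT the (T1′) socket's debt is ONE letter: the composite gauge factor's gradient row sum `ab ≍ N⁻¹` (ours; a dipole ∕ symbol
estimate for `(S_ν−1)·∂G′RG′∂ᴴ` — every two-factor split of it through row-sum norms loses `log N`; NOT attempted here).  NOT (T1′) unconditional, NOT hslice,
NOT (ASYMP), NOT D1, NOT BetaPertH, NOT continuum, NOT Clay.

ABSOLUTE RULE (cell charter, verbatim): «No internally-minted statement may enter as a cited fact. Every hypothesis is either kernel-proved in this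
package or a verbatim quotation of a PUBLISHED theorem with page reference. The manuscript(s) under audit are NOT citable for their own disputed
steps — they are the thing under adjudication; programme-internal (2001/route/tribunal) claims are never citable.»

CONTENT.  §1 **`exists_rowSum_shift_calG_one_cubic`**: `∃ g ≥ 0, ∀ n N₀ ≥ 1, ∀ ν i, Σ_j ‖((S_ν − 1)·Δ_1⁻¹) i j‖ ≤ g∕n` on the cubic fine torus
`Tor (fine n (fun _ => N₀))` (`calG = Δ_1⁻¹`, `B5DeltaA169.calG_eq_DeltaA_inv`; `∇_ν = n•(S_ν − 1)`); §2 **`exists_rowDiff_Cov_tower_of_gaugeLetter`**: for odd `L > 1`,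
from the displayed composite letter `ab∕N` on the tower tori, `∃ C₁, ∀ P (P.d = d+1, P.L = L, P.K ≥ 1), ∀ i μ, Σ_j ‖𝒞(i.1+ê_μ, i.2) j − 𝒞 i j‖ ≤ C₁∕(nP P)` —
EXACTLY the `hC1` of F5b ∕ F5c (`C₁ = g + ab + g·c_C·c_G`); §3 THE END OF THE SOCKET (road `d = 3`): **`sum_abs_KPerf_ff_colDiff_le_of_gaugeLetter`** ((T1′) in
RHOA-3's `hT1` shape ⟸ `hAB`), **`exists_abs_rho_road_sub_right_le_of_gaugeLetter`** (hR1′ ⟸ `hAB`), **`exists_abs_rho_road_sub_sub_le_of_gaugeLetter`** (hR2 ⟸ `hAB`) —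
F5b ∕ F5c with their `hC1` supplied by §2.
Unit `b2b-balaban-beta-d1-formalise-leaf-05` (gen 22), 2026-08-21; `LEAVES-FP.md` row «(T1′) SOCKET F5e».  «not in print; our bookkeeping».
-/

noncomputable section

open scoped BigOperators Matrix ComplexConjugate

namespace Summit.QuantumFields.BalabanUV.Beta.FP.CovarianceRowDiffTower

open Literature.MathematicalPhysics.QuantumFieldTheory.Balaban1983to89
open Literature.MathematicalPhysics.QuantumFieldTheory.Balaban1983to89.B5Prop11Plancherel (Tor fine calG shiftM fdiff unitVec)
open Literature.MathematicalPhysics.QuantumFieldTheory.Balaban1983to89.B5Action121 (GradOp)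
open Literature.MathematicalPhysics.QuantumFieldTheory.Balaban1983to89.B5Block118 (QvOp)
open Literature.MathematicalPhysics.QuantumFieldTheory.Balaban1983to89.B5LaplaceInverse (LapSinv)
open Literature.MathematicalPhysics.QuantumFieldTheory.Balaban1983to89.B5DeltaA169 (QvAdj DeltaA calG_eq_DeltaA_inv)
open Literature.MathematicalPhysics.QuantumFieldTheory.Balaban1983to89.B5Identities197Torus (RT)
open Literature.MathematicalPhysics.QuantumFieldTheory.Balaban1983to89.Beta.FluctuationProjection (Cov QGQ)
open Literature.MathematicalPhysics.QuantumFieldTheory.Balaban1983to89.B4TorusKernel (periodConst)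
open Literature.MathematicalPhysics.QuantumFieldTheory.Balaban1983to89.B5G183Strip (kappa183)
open Literature.MathematicalPhysics.QuantumFieldTheory.Balaban1983to89.B5G183CovDecay (MD183)
open Literature.MathematicalPhysics.QuantumFieldTheory.Balaban1983to89.B4Sect5Proof (latticeConst latticeConst_nonneg)
open Literature.MathematicalPhysics.QuantumFieldTheory.Balaban1983to89.B5G115RowSum (sum_norm_DeltaA_one_inv_le)
open B5SiteBridgeP12 (nP MP one_le_nP)
open Summit.QuantumFields.BalabanUV.T4Continuum.GradientRowSumTransport (weighted_row_sum_fdiff_inv_le_cubic)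
open Summit.QuantumFields.BalabanUV.Beta.FP.CovarianceConstraintRowSum (exists_rowSum_constraint_le)
open Summit.QuantumFields.BalabanUV.Beta.FP.CovarianceRowDiff (sum_norm_Cov_rowDiff_le)
open Summit.QuantumFields.BalabanUV.Beta.FP.PerfectFFBlockRowDiff (sum_abs_KPerf_ff_colDiff_le)
open Summit.QuantumFields.BalabanUV.Beta.FP.GaugeTermRoadLegsCol (exists_abs_rho_road_sub_right_le exists_abs_rho_road_sub_sub_le)

variable {d : ℕ}

/-! ## §1 The vector propagator's gradient row-sum letter on cubic tori is in the tree -/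

/-- [our bookkeeping] **(1.115), SECOND ENTRY, FOR THE VECTOR `G = Δ_1⁻¹` IN ROW-SUM CURRENCY ON CUBIC TORI — A THEOREM OF THE TREE**: there is `g ≥ 0`
(a function of `d`) with, for every spacing `n ≥ 1`, every cubic unit torus `N₀ ≥ 1`, every direction `ν` and every row `i`,
`Σ_j ‖((S_ν − 1)·Δ_1⁻¹) i j‖ ≤ g∕n` — t4-ne2-formalise-leaf-05's `GradientRowSumTransport.weighted_row_sum_fdiff_inv_le_cubic` at weight `δ′ = 0`
(inside: t4-ne3-p1's `SliceFlatGradient.cubeSum_rowDiff_gFlat_le`), the lattice factor `n` of `∇_ν = n•(S_ν − 1)` moved to the right-hand side. -/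
theorem exists_rowSum_shift_calG_one_cubic :
    ∃ g : ℝ, 0 ≤ g ∧ ∀ (n N₀ : ℕ) [NeZero n] [NeZero N₀] (hn : 1 ≤ n) (ν : Fin (d + 1))
      (i : Tor (fine n (fun _ : Fin (d + 1) => N₀)) × Fin (d + 1)),
        ∑ j, ‖((shiftM (fine n (fun _ : Fin (d + 1) => N₀)) ν - 1) * calG n hn (fun _ : Fin (d + 1) => N₀) 1 one_pos) i j‖ ≤ g / n := by
  obtain ⟨B, δ, hB, hδ, h⟩ := weighted_row_sum_fdiff_inv_le_cubic (d := d)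
  refine ⟨B * latticeConst (d + 1) δ, mul_nonneg hB.le (latticeConst_nonneg _ hδ.le), fun n N₀ _ _ hn ν i => ?_⟩
  have h0 := h n N₀ 0 hδ ν i
  simp only [zero_mul, Real.exp_zero, one_mul, sub_zero] at h0
  have hn0 : (0 : ℝ) < n := by exact_mod_cast hn
  -- `∇_ν·Δ_1⁻¹ = n • ((S_ν − 1)·Δ_1⁻¹)` entrywise
  have hentry : ∀ j, ‖(fdiff (fine n (fun _ : Fin (d + 1) => N₀)) (n : ℂ) ν * (DeltaA n (fun _ : Fin (d + 1) => N₀) 1)⁻¹) i j‖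
      = (n : ℝ) * ‖((shiftM (fine n (fun _ : Fin (d + 1) => N₀)) ν - 1) * calG n hn (fun _ : Fin (d + 1) => N₀) 1 one_pos) i j‖ := by
    intro j
    rw [calG_eq_DeltaA_inv, fdiff, Matrix.smul_mul, Matrix.smul_apply, norm_smul, Complex.norm_natCast]
  simp_rw [hentry, ← Finset.mul_sum] at h0
  rw [le_div_iff₀ hn0, mul_comm]
  exact h0

/-! ## §2 The tower letter `hC1` from ONE composite gauge letter -/

/-- [our bookkeeping] **THE (T1′) SOCKET's TOWER LETTER FROM THE COMPOSITE GAUGE LETTER ALONE**: for odd `L > 1`, if the free × coarse gauge factor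
`∂Δ⁻¹R·RΔ⁻¹∂ᴴ` carries the gradient row-sum letter `ab∕N` on the tower tori (`N = nP P`, cubic `M = MP P`), then the hard covariance carries
`Σ_j ‖𝒞(i.1+ê_μ, i.2) j − 𝒞 i j‖ ≤ C₁∕N` there, `C₁ = g + ab + g·c_C·c_G` — EXACTLY the displayed `hC1` of `PerfectFFBlockRowDiff` ∕ `GaugeTermRoadLegsCol`
(§1 + gan24's `c_C` + pv15's `c_G` + F5d). -/
theorem exists_rowDiff_Cov_tower_of_gaugeLetter (L : ℕ) (hL : Odd L ∧ 1 < L) {ab : ℝ}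
    (hAB : ∀ P : Params, P.d = d + 1 → P.L = L → 1 ≤ P.K →
      ∀ (ν : Fin P.d) (i : Tor (fine (nP P) (MP P)) × Fin P.d),
        ∑ j, ‖((shiftM (fine (nP P) (MP P)) ν - 1) *
          ((GradOp (fine (nP P) (MP P)) (nP P : ℂ) * LapSinv (fine (nP P) (MP P)) (nP P : ℂ) * RT (nP P) (MP P))
            * (RT (nP P) (MP P) * LapSinv (fine (nP P) (MP P)) (nP P : ℂ) * (GradOp (fine (nP P) (MP P)) (nP P : ℂ))ᴴ))
          : Matrix (Tor (fine (nP P) (MP P)) × Fin P.d) (Tor (fine (nP P) (MP P)) × Fin P.d) ℂ) i j‖ ≤ ab / (nP P : ℝ)) :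
    ∃ C₁ : ℝ, ∀ P : Params, P.d = d + 1 → P.L = L → 1 ≤ P.K →
      ∀ (i : Tor (fine (nP P) (MP P)) × Fin P.d) (μ : Fin P.d),
        ∑ j, ‖Cov (nP P) (one_le_nP P) (MP P) 1 one_pos (i.1 + unitVec (fine (nP P) (MP P)) μ, i.2) j
          - Cov (nP P) (one_le_nP P) (MP P) 1 one_pos i j‖ ≤ C₁ / (nP P : ℝ) := by
  obtain ⟨g, hg, hG1⟩ := exists_rowSum_shift_calG_one_cubic (d := d)
  obtain ⟨c₀, δ₀, hc, hδ, hCC⟩ := exists_rowSum_constraint_le (d := d)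
  set cC : ℝ := (d + 1) * (1 + c₀) * latticeConst (d + 1) δ₀ with hcC
  set cG : ℝ := 2 * d * 2 ^ d * Real.exp (1 / (2 * (d + 1))) * latticeConst (d + 1) (1 / (2 * (d + 1)))
    + (d + 1) * (MD183 (d + 1) d * periodConst (kappa183 (d + 1)) d * latticeConst (d + 1) (kappa183 (d + 1) / (d + 1))) with hcG
  refine ⟨g + ab + g * cC * cG, fun P => ?_⟩
  obtain ⟨Pd, PL, Pm, PK, Phd, PhL⟩ := P
  intro hPd hPL hK
  simp only at hPd hPL hK
  subst Pd
  subst PL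
  set P : Params := ⟨d + 1, L, Pm, PK, Phd, PhL⟩ with hP
  intro i μ
  haveI : NeZero (2 * L ^ Pm) := ⟨by have := hL.2; positivity⟩
  have hn0 : (0 : ℝ) < nP P := by exact_mod_cast one_le_nP P
  -- the four letters on this torus
  have h1 : ∀ i' : Tor (fine (nP P) (MP P)) × Fin (d + 1),
      ∑ j, ‖((shiftM (fine (nP P) (MP P)) μ - 1) * calG (nP P) (one_le_nP P) (MP P) 1 one_pos) i' j‖ ≤ g / (nP P : ℝ) :=
    fun i' => hG1 (nP P) (2 * L ^ Pm) (one_le_nP P) μ i'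
  have h2 := hAB P rfl rfl hK μ
  have h3 : ∀ i' : Tor (fine (nP P) (MP P)) × Fin (d + 1),
      ∑ j, ‖(QvAdj (nP P) (MP P) * (QGQ (nP P) (one_le_nP P) (MP P) 1 one_pos)⁻¹ * QvOp (nP P) (MP P)) i' j‖ ≤ cC := by
    intro i'
    have h := hCC (nP P) (one_le_nP P) (MP P) 1 one_pos i'
    rw [hcC]; exact h
  have h4 : ∀ i' : Tor (fine (nP P) (MP P)) × Fin (d + 1), ∑ j, ‖calG (nP P) (one_le_nP P) (MP P) 1 one_pos i' j‖ ≤ cG := by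
    intro i'
    rw [calG_eq_DeltaA_inv, hcG]
    exact sum_norm_DeltaA_one_inv_le (nP P) (one_le_nP P) (MP P) (Nn := d) le_rfl i'
  have h := sum_norm_Cov_rowDiff_le (nP P) (one_le_nP P) (MP P) 1 one_pos μ h1 h2 h3 h4 i
  refine h.trans (le_of_eq ?_)
  field_simp

/-! ## §3 The END of the (T1′) socket on the road (`d = 3`): (T1′), hR1′, hR2 from the composite gauge letter alone -/

section Road

open Literature.MathematicalPhysics.QuantumFieldTheory.Balaban1983to89.Beta
open Literature.MathematicalPhysics.QuantumFieldTheory.Balaban1983to89.Beta.DyadicShell (Pt)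
open Literature.Probability.LatticeModels (latticeGreen)
open Summit.QuantumFields.BalabanUV.Beta.GAN24.CombesThomas (sfStep smStep)
open Summit.QuantumFields.BalabanUV.Beta.FP.PerfectObjectsT (KPerf)
open Summit.QuantumFields.BalabanUV.Beta.FP.SliceProjectorKernel (piC)

variable {Lc : ℕ} [NeZero Lc]

/-- [our object] **(T1′) IN RHOA-3's `hT1` SHAPE FROM THE COMPOSITE GAUGE LETTER ALONE** (`d = 3`, odd `Lc > 1`): `∃ A₁, ∀ m ≥ 1, ∀ w μ κ l Q,
`Σ_{q∈Q} |KPerf … m q (w+e_μ) (inl κ) (inl l) − KPerf … m q w (inl κ) (inl l)| ≤ A₁·Lc^m` — F5b's `sum_abs_KPerf_ff_colDiff_le` with `hC1` from §2. -/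
theorem sum_abs_KPerf_ff_colDiff_le_of_gaugeLetter (hLc : Odd Lc ∧ 1 < Lc) {ab : ℝ}
    (hAB : ∀ P : Params, P.d = 3 + 1 → P.L = Lc → 1 ≤ P.K →
      ∀ (ν : Fin P.d) (i : Tor (fine (nP P) (MP P)) × Fin P.d),
        ∑ j, ‖((shiftM (fine (nP P) (MP P)) ν - 1) *
          ((GradOp (fine (nP P) (MP P)) (nP P : ℂ) * LapSinv (fine (nP P) (MP P)) (nP P : ℂ) * RT (nP P) (MP P))
            * (RT (nP P) (MP P) * LapSinv (fine (nP P) (MP P)) (nP P : ℂ) * (GradOp (fine (nP P) (MP P)) (nP P : ℂ))ᴴ))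
          : Matrix (Tor (fine (nP P) (MP P)) × Fin P.d) (Tor (fine (nP P) (MP P)) × Fin P.d) ℂ) i j‖ ≤ ab / (nP P : ℝ)) :
    ∃ A₁ : ℝ, ∀ m : ℕ, 1 ≤ m → ∀ (w : AffineAveraging.Site (3 + 1)) (μ κ l : Fin (3 + 1)) (Q : Finset (AffineAveraging.Site (3 + 1))),
      ∑ q ∈ Q, |KPerf (d := 3) Lc (sfStep Lc) (smStep 3 Lc) m q (w + AffineAveraging.unitVec μ) (Sum.inl κ) (Sum.inl l)
          - KPerf (d := 3) Lc (sfStep Lc) (smStep 3 Lc) m q w (Sum.inl κ) (Sum.inl l)| ≤ A₁ * (Lc : ℝ) ^ m := by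
  obtain ⟨C₁, hC1⟩ := exists_rowDiff_Cov_tower_of_gaugeLetter (d := 3) Lc hLc hAB
  exact ⟨C₁ / 2, fun m hm w μ κ l Q => sum_abs_KPerf_ff_colDiff_le hLc hC1 hm w μ κ l Q⟩

/-- [our object] **`hR1′` OF THE (R1) GAUGE TERM FROM THE COMPOSITE GAUGE LETTER ALONE**: `∃ B₁′, ∀ m ≥ 1, ∀ μ ν l j p w,
|ρ p (w+e_j) − ρ p w| ≤ B₁′∕((Lc)^m)³` — F5c's `exists_abs_rho_road_sub_right_le` with `hC1` from §2. -/
theorem exists_abs_rho_road_sub_right_le_of_gaugeLetter (hLc : Odd Lc ∧ 1 < Lc) {ab : ℝ}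
    (hAB : ∀ P : Params, P.d = 3 + 1 → P.L = Lc → 1 ≤ P.K →
      ∀ (ν : Fin P.d) (i : Tor (fine (nP P) (MP P)) × Fin P.d),
        ∑ j, ‖((shiftM (fine (nP P) (MP P)) ν - 1) *
          ((GradOp (fine (nP P) (MP P)) (nP P : ℂ) * LapSinv (fine (nP P) (MP P)) (nP P : ℂ) * RT (nP P) (MP P))
            * (RT (nP P) (MP P) * LapSinv (fine (nP P) (MP P)) (nP P : ℂ) * (GradOp (fine (nP P) (MP P)) (nP P : ℂ))ᴴ))
          : Matrix (Tor (fine (nP P) (MP P)) × Fin P.d) (Tor (fine (nP P) (MP P)) × Fin P.d) ℂ) i j‖ ≤ ab / (nP P : ℝ)) :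
    ∃ B₁' : ℝ, ∀ m : ℕ, 1 ≤ m → ∀ (μ ν l j : Fin 4) (p w : Pt),
      |(∑' xq : Pt × Pt, (latticeGreen (p - xq.1 + Pi.single μ 1) / 2 - latticeGreen (p - xq.1) / 2)
            * (piC (d := 3) (Lc ^ m) xq.1 (xq.2 + AffineAveraging.unitVec ν) - piC (d := 3) (Lc ^ m) xq.1 xq.2).re
            * KPerf (d := 3) Lc (sfStep Lc) (smStep 3 Lc) m xq.2 (w + AffineAveraging.unitVec j) (Sum.inl ν) (Sum.inl l))
          - ∑' xq : Pt × Pt, (latticeGreen (p - xq.1 + Pi.single μ 1) / 2 - latticeGreen (p - xq.1) / 2)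
            * (piC (d := 3) (Lc ^ m) xq.1 (xq.2 + AffineAveraging.unitVec ν) - piC (d := 3) (Lc ^ m) xq.1 xq.2).re
            * KPerf (d := 3) Lc (sfStep Lc) (smStep 3 Lc) m xq.2 w (Sum.inl ν) (Sum.inl l)|
        ≤ B₁' / ((Lc : ℝ) ^ m) ^ 3 := by
  obtain ⟨C₁, hC1⟩ := exists_rowDiff_Cov_tower_of_gaugeLetter (d := 3) Lc hLc hAB
  exact exists_abs_rho_road_sub_right_le hLc hC1

/-- [our object] **`hR2` OF THE (R1) GAUGE TERM FROM THE COMPOSITE GAUGE LETTER ALONE**: `∃ B₂, ∀ m ≥ 1, ∀ μ ν l i j p w,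
|ρ (p+e_i) (w+e_j) − ρ p (w+e_j) − ρ (p+e_i) w + ρ p w| ≤ B₂∕((Lc)^m)⁴` — F5c's `exists_abs_rho_road_sub_sub_le` with `hC1` from §2. -/
theorem exists_abs_rho_road_sub_sub_le_of_gaugeLetter (hLc : Odd Lc ∧ 1 < Lc) {ab : ℝ}
    (hAB : ∀ P : Params, P.d = 3 + 1 → P.L = Lc → 1 ≤ P.K →
      ∀ (ν : Fin P.d) (i : Tor (fine (nP P) (MP P)) × Fin P.d),
        ∑ j, ‖((shiftM (fine (nP P) (MP P)) ν - 1) *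
          ((GradOp (fine (nP P) (MP P)) (nP P : ℂ) * LapSinv (fine (nP P) (MP P)) (nP P : ℂ) * RT (nP P) (MP P))
            * (RT (nP P) (MP P) * LapSinv (fine (nP P) (MP P)) (nP P : ℂ) * (GradOp (fine (nP P) (MP P)) (nP P : ℂ))ᴴ))
          : Matrix (Tor (fine (nP P) (MP P)) × Fin P.d) (Tor (fine (nP P) (MP P)) × Fin P.d) ℂ) i j‖ ≤ ab / (nP P : ℝ)) :
    ∃ B₂ : ℝ, ∀ m : ℕ, 1 ≤ m → ∀ (μ ν l i j : Fin 4) (p w : Pt),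
      |(∑' xq : Pt × Pt, (latticeGreen (p + AffineAveraging.unitVec i - xq.1 + Pi.single μ 1) / 2
              - latticeGreen (p + AffineAveraging.unitVec i - xq.1) / 2)
            * (piC (d := 3) (Lc ^ m) xq.1 (xq.2 + AffineAveraging.unitVec ν) - piC (d := 3) (Lc ^ m) xq.1 xq.2).re
            * KPerf (d := 3) Lc (sfStep Lc) (smStep 3 Lc) m xq.2 (w + AffineAveraging.unitVec j) (Sum.inl ν) (Sum.inl l))
          - (∑' xq : Pt × Pt, (latticeGreen (p - xq.1 + Pi.single μ 1) / 2 - latticeGreen (p - xq.1) / 2)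
            * (piC (d := 3) (Lc ^ m) xq.1 (xq.2 + AffineAveraging.unitVec ν) - piC (d := 3) (Lc ^ m) xq.1 xq.2).re
            * KPerf (d := 3) Lc (sfStep Lc) (smStep 3 Lc) m xq.2 (w + AffineAveraging.unitVec j) (Sum.inl ν) (Sum.inl l))
          - (∑' xq : Pt × Pt, (latticeGreen (p + AffineAveraging.unitVec i - xq.1 + Pi.single μ 1) / 2
              - latticeGreen (p + AffineAveraging.unitVec i - xq.1) / 2)
            * (piC (d := 3) (Lc ^ m) xq.1 (xq.2 + AffineAveraging.unitVec ν) - piC (d := 3) (Lc ^ m) xq.1 xq.2).re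
            * KPerf (d := 3) Lc (sfStep Lc) (smStep 3 Lc) m xq.2 w (Sum.inl ν) (Sum.inl l))
          + ∑' xq : Pt × Pt, (latticeGreen (p - xq.1 + Pi.single μ 1) / 2 - latticeGreen (p - xq.1) / 2)
            * (piC (d := 3) (Lc ^ m) xq.1 (xq.2 + AffineAveraging.unitVec ν) - piC (d := 3) (Lc ^ m) xq.1 xq.2).re
            * KPerf (d := 3) Lc (sfStep Lc) (smStep 3 Lc) m xq.2 w (Sum.inl ν) (Sum.inl l)|
        ≤ B₂ / ((Lc : ℝ) ^ m) ^ 4 := by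
  obtain ⟨C₁, hC1⟩ := exists_rowDiff_Cov_tower_of_gaugeLetter (d := 3) Lc hLc hAB
  exact exists_abs_rho_road_sub_sub_le hLc hC1

end Road

end Summit.QuantumFields.BalabanUV.Beta.FP.CovarianceRowDiffTower

end
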